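import Literature.AlgebraicGeometry.Motives.AbelianVarietyProduct
import Literature.AlgebraicGeometry.Motives.AbelianVarietyProductDimProofs
import Literature.AlgebraicGeometry.Motives.AbelianVarietyProjectiveChart
import Literature.AlgebraicGeometry.HodgeTheory.HodgeTypePullback
import Literature.AlgebraicGeometry.HodgeTheory.CupPreservesHodgeTypeOfDeRham
import Literature.AlgebraicGeometry.HodgeTheory.HodgeModelExistence
import Literature.AlgebraicGeometry.HodgeTheory.HodgeFiltrationModelsReductionProofs
import Summits.HodgeConjecture.HodgeConjecture.Theorems.HeckePrymWeilWeilTwelvefoldsSqrtMinus7HodgeModelFacts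
import HarnessLib

/-!
# Crux `WeilTwelvefoldsSqrtMinus7` (stmt-HodgeConjecture-1261), line `amnesic-secant-sheaves-split-fourteenfolds` — stub `stub_hodgeTypeExterior`

Künneth for Hodge types of exterior products on a product of complex abelian varieties, modulo de
Rham's theorem in multiplicative form (`exists_deRhamIsoFamily`, the one Literature named fact left
after `nonempty_hodgeModel_all_holds`, same directory, discharged the existence of Hodge models): if `c ∈ Hᵏ(A(ℂ); ℂ)` is of
Hodge type `(p, q)` and `w ∈ Hˡ(B(ℂ); ℂ)` of type `(p', q')`, then `pr_A^* c ⌣ pr_B^* w` is of type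
`(p + p', q + q')` on `A × B` (Voisin, *Hodge Theory I*, §7.3.2 and §11.3.2 / Thm. 11.38).

Proof: a Hodge model of `(A × B).X` exists by `nonempty_hodgeModel_all_holds` (GAGA + de Rham +
Hodge decomposition, proved in `…HodgeModelFacts`); pull-backs along `pr_A`, `pr_B` preserve Hodge types
(`preservesHodgeType_of_independent`, Voisin I §7.3.2, with the PROVED rigidity
`hodgePQ_independent_of_hodgeModel_holds`); the cup product preserves Hodge types given de Rham's
theorem in multiplicative form (`cupPreservesHodgeType_of_exists_deRhamIsoFamily`, Voisin I Thm. 5.29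
and §7.1.2). The statement is the registered stub `stub_hodgeTypeExterior` of the line's skeleton
(lead's reshape r2: de Rham's theorem is the explicit antecedent), shared verbatim (after the
antecedents) with `WeilSixfoldsSqrtMinus7/Lines/hyperbolic-eightfold-descent` stub 4 and the engine of
route item 1263 `WeilDescending`.
-/

noncomputable section

set_option linter.dupNamespace false

open CategoryTheory Complex
open Literature.AlgebraicGeometry Literature.AlgebraicGeometry.Motives
  Literature.AlgebraicGeometry.HodgeTheory Literature.AlgebraicTopology.SingularHomology

namespace Summit.HodgeConjecture.HodgeConjecture.Theorems.WeilTwelvefoldsSqrtMinus7.AmnesicSecantSheaves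

/-- **Hodge types of exterior products on `A × B` (Künneth for Hodge types), modulo de Rham's theorem
in multiplicative form `exists_deRhamIsoFamily`.** For complex abelian varieties `A`, `B` of
dimensions `a`, `b`, a class `c ∈ Hᵏ(A(ℂ); ℂ)` of Hodge type `(p, q)` and `w ∈ Hˡ(B(ℂ); ℂ)` of type
`(p', q')`, the class `pr_A^* c ⌣ pr_B^* w ∈ H^{k+l}((A × B)(ℂ); ℂ)` is of Hodge type
`(p + p', q + q')` for the dimension parameter `a + b`. Registered stub `stub_hodgeTypeExterior` of
line `amnesic-secant-sheaves-split-fourteenfolds` (crux stmt-HodgeConjecture-1261).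
[cite: VoisinHodgeI2002, §7.3.2 and §11.3.2] -/
theorem stub_hodgeTypeExterior :
    (∀ (E : Type) [NormedAddCommGroup E] [NormedSpace ℂ E] [FiniteDimensional ℂ E],
      Literature.NumberTheory.Transcendental.exists_deRhamIsoFamily (modelWithCornersSelf ℝ E)) →
    ∀ (A B : AbelianVariety ℂ) (a b : ℕ), A.dim = a → B.dim = b →
    ∀ (k l m : ℕ) (hklm : k + l = m) (p q p' q' : ℕ)
      (c : complexBetti A.X k) (w : complexBetti B.X l),
      IsOfHodgeType a A.X k p q c → IsOfHodgeType b B.X l p' q' w →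
      IsOfHodgeType (a + b) (A.prod B).X m (p + p') (q + q')
        (cupProduct hklm (complexBetti.map (AbelianVariety.fst A B).hom.hom.hom k c)
          (complexBetti.map (AbelianVariety.snd A B).hom.hom.hom l w)) := by
  intro hdR A B a b hA hB k l m hklm p q p' q' c w hc hw
  -- smooth projectivity of the three varieties, in the dimensions of the statement
  have hA' : IsSmoothProjective a A.X := by
    have h : IsSmoothProjective A.dim A.X := AbelianVariety.isSmoothProjective_holds (A := A)
    rwa [hA] at h
  have hB' : IsSmoothProjective b B.X := by
    have h : IsSmoothProjective B.dim B.X := AbelianVariety.isSmoothProjective_holds (A := B)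
    rwa [hB] at h
  have hAB : IsSmoothProjective (a + b) (A.prod B).X := by
    have h : IsSmoothProjective (A.prod B).dim (A.prod B).X :=
      AbelianVariety.isSmoothProjective_holds (A := A.prod B)
    rwa [AbelianVariety.dim_prod, hA, hB] at h
  -- a Hodge model of the product (`nonempty_hodgeModel_all_holds`, landed p84975)
  obtain ⟨M⟩ := (nonempty_hodgeModel_all_holds (a + b) (A.prod B).X).nonempty hAB
  -- pull-backs along the projections preserve Hodge types (Voisin I §7.3.2)
  have hc' : IsOfHodgeType (a + b) (A.prod B).X k p q
      (complexBetti.map (AbelianVariety.fst A B).hom.hom.hom k c) :=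
    preservesHodgeType_of_independent hodgePQ_independent_of_hodgeModel_holds hAB hA' M
      (AbelianVariety.fst A B).hom.hom.hom hc
  have hw' : IsOfHodgeType (a + b) (A.prod B).X l p' q'
      (complexBetti.map (AbelianVariety.snd A B).hom.hom.hom l w) :=
    preservesHodgeType_of_independent hodgePQ_independent_of_hodgeModel_holds hAB hB' M
      (AbelianVariety.snd A B).hom.hom.hom hw
  -- the cup product preserves Hodge types (Voisin I Thm. 5.29, §7.1.2), given de Rham's theorem
  exact cupPreservesHodgeType_of_exists_deRhamIsoFamily hodgePQ_independent_of_hodgeModel_holds hAB M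
    (hdR M.model) hklm hc' hw'

end Summit.HodgeConjecture.HodgeConjecture.Theorems.WeilTwelvefoldsSqrtMinus7.AmnesicSecantSheaves

end
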